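/-
# B3HubTrace — the HUB-TRACE law for hub monads (hsemireg-monad-4 g13; evidence on stmt-HodgeConjecture-18881)

token: line stmt-HodgeConjecture-18881 Cruxes/BlochSeedDiscOne/Lines/birth.lean 814a6a70c14e831a stub_rung_pad4_seedAt (helper)

Companion of the memo `B3-HUBTRACE-monad4-g13.md`.  Mathlib only; every declaration fully proved; no
type-class declarations, no custom syntax, no unsafe options.  Typed here: the CHECKABLE SKELETON of the pen theorem:

* §1 the two linear-algebra steps of the proof (memo 2.2/2.3): a linear map whose kernel is trapped in a
  subspace `U` has rank ≥ dim V − dim U; a family of linear maps with a common non-zero kernel vector is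
  not jointly injective on any index window (the shape of `IsISemiregular`, tree
  `Literature/AlgebraicGeometry/HodgeTheory/SemiregularityMap.lean`);
* §2 the per-factor cohomology table of the position alphabet and the Künneth extractor, with the three
  letter facts (N3) used by the proof, checked by `decide` on the famdesign alphabet;
* §3 the bound `hubTraceLB c s = 4((c−s)²−1)` and the rows of the memo's §5 table (D48: 60, T40: 572,
  the TWIST ray), the count identity of memo 2.3, and the σ-target dimensions 3136 / 5572 / 8008.

Nothing here is a theorem about sheaves on an abelian variety: the geometric content (the cocycles
ξ_{f,M}, their non-vanishing and σ-vanishing) is pen (memo §2).  Designs ≠ sheaves ≠ SEED; nothing is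
proved toward HC / HC_CM / HC_AV / №4 / 26512 / 18881 / H2.
-/
import Mathlib

namespace Summit.Ventures.HSemireg.B3HubTrace

/-! ## §1 Linear algebra of memo 2.2–2.3 -/
section LinearAlgebra

variable {K V W : Type*} [Field K] [AddCommGroup V] [Module K V] [FiniteDimensional K V]
  [AddCommGroup W] [Module K W]

/-- Memo 2.2 ⇒ 2.3: if `ker Φ ≤ U` then `rank Φ ≥ dim V − dim U`. -/
theorem finrank_sub_le_finrank_range_of_ker_le (Φ : V →ₗ[K] W) (U : Submodule K V)
    (h : LinearMap.ker Φ ≤ U) :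
    Module.finrank K V - Module.finrank K U ≤ Module.finrank K (LinearMap.range Φ) := by
  have h1 := LinearMap.finrank_range_add_finrank_ker Φ
  have h2 : Module.finrank K (LinearMap.ker Φ) ≤ Module.finrank K U := Submodule.finrank_mono h
  omega

/-- The count of memo 2.3 in letters: with `dim Ann(S)^{⊕4} = 4c(c−s)`, the traceless part `U` of
codimension ≤ 4 and `dim ker Φ ≤ 4 s (c−s)`, one gets `dim Φ(U) ≥ 4((c−s)² − 1)`. (Over `ℤ`.) -/
theorem hubTrace_count (c s : ℤ) :
    (4 * c * (c - s) - 4) - 4 * s * (c - s) = 4 * ((c - s) ^ 2 - 1) := by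
  ring

variable {ι : Type*} {T : ι → Type*} [∀ k, AddCommGroup (T k)] [∀ k, Module K (T k)]

/-- The shape of `AtiyahTraceAlgebra.IsISemiregular` / `HomComplex.IsISemiregularC`: the part
`(σ_k)_{k ∈ I}` of a family of linear maps is jointly injective. -/
def IsISemiregularFamily (σ : (k : ι) → V →ₗ[K] T k) (I : Set ι) : Prop :=
  ∀ x : V, (∀ k ∈ I, σ k x = 0) → x = 0

omit [FiniteDimensional K V] in
/-- A non-zero vector killed by EVERY `σ_k` refutes `I`-semiregularity for EVERY window `I`
(memo §0.1: "not I-semiregular for any I"). -/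
theorem not_isISemiregularFamily_of_common_kernel (σ : (k : ι) → V →ₗ[K] T k) (I : Set ι)
    (v : V) (hv : v ≠ 0) (h : ∀ k, σ k v = 0) : ¬ IsISemiregularFamily σ I := by
  intro hI
  exact hv (hI v (fun k _ => h k))

/-- Subspace form: a subspace of positive dimension inside every `ker σ_k` refutes
`I`-semiregularity for every `I`. -/
theorem not_isISemiregularFamily_of_subspace (σ : (k : ι) → V →ₗ[K] T k) (I : Set ι)
    (Z : Submodule K V) (hZ : 0 < Module.finrank K Z) (h : ∀ k, Z ≤ LinearMap.ker (σ k)) :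
    ¬ IsISemiregularFamily σ I := by
  obtain ⟨z, hz⟩ := (Module.finrank_pos_iff_exists_ne_zero (R := K) (M := Z)).mp hZ
  refine not_isISemiregularFamily_of_common_kernel σ I (z : V) ?_ ?_
  · intro h0
    apply hz
    exact_mod_cast h0
  · intro k
    exact LinearMap.mem_ker.mp (h k z.2)

end LinearAlgebra

/-! ## §2 The per-factor table and the letter facts (N3) -/

/-- A factor letter `(14 − c, c·ω)`: `ch = c` (0 = the trivial letter `H = (14,0)`), `rot` = `ω = i^rot`. -/
abbrev FL := ℕ × Fin 4

/-- `|i^a − i^b|²` ∈ {0, 2, 4}. -/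
def absSq (a b : Fin 4) : ℕ := if a = b then 0 else if a + 2 = b then 4 else 2

/-- Per-factor cohomology `(h⁰, h¹, h²)` of `Hom(Z_x, Z_{x'})` on `S = E × E` (memo §4, c4-1 g5 §1):
same chain or one side trivial, `d = c − c'`: `d > 0 ↦ (d,d,0)`, `d < 0 ↦ (0,|d|,|d|)`, `d = 0 ↦ (1,2,1)`;
two different chains with `c, c' > 0 ↦ (0, c c' |ω − ω'|², 0)`. -/
def hfac (x x' : FL) : ℕ × ℕ × ℕ :=
  if x.1 = 0 ∧ x'.1 = 0 then (1, 2, 1)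
  else if x.1 = 0 then (0, x'.1, x'.1)
  else if x'.1 = 0 then (x.1, x.1, 0)
  else if x.2 = x'.2 then
    (if x'.1 < x.1 then (x.1 - x'.1, x.1 - x'.1, 0)
     else if x.1 < x'.1 then (0, x'.1 - x.1, x'.1 - x.1) else (1, 2, 1))
  else (0, x.1 * x'.1 * absSq x.2 x'.2, 0)

/-- Component `j ∈ {0,1,2}` of a factor triple. -/
def comp (t : ℕ × ℕ × ℕ) : Fin 3 → ℕ
  | 0 => t.1
  | 1 => t.2.1
  | 2 => t.2.2

/-- A cell = one factor letter per factor of `X = S⁴`. -/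
abbrev Cell := Fin 4 → FL

/-- All multidegrees `k ∈ {0,1,2}⁴`. -/
def multidegs : List (Fin 4 → Fin 3) :=
  (List.finRange 3).flatMap fun a => (List.finRange 3).flatMap fun b =>
    (List.finRange 3).flatMap fun c => (List.finRange 3).map fun d => ![a, b, c, d]

/-- Künneth: `h^j(X, Hom(Z, Z')) = Σ_{|k| = j} ∏_f h^{k_f}` of the factor triples. -/
def hj (j : ℕ) (z z' : Cell) : ℕ :=
  (multidegs.filter fun k => ((List.finRange 4).map fun f => (k f : ℕ)).sum = j).foldr
    (fun k acc => acc + ((List.finRange 4).map fun f => comp (hfac (z f) (z' f)) (k f)).prod) 0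

/-- The hub letter `83 = (14,0)⁴`. -/
def hub : Cell := fun _ => (0, 0)
/-- `N18_w = (ω',1)@k ⊗ (iω',2)@sides`, `w = (k, ω' = i^a)`. -/
def n18 (k : Fin 4) (a : Fin 4) : Cell := fun f => if f = k then (1, a) else (2, a + 1)
/-- The towers `P46_w = (ω,5)@k`, `P53_w = (ω,4)@k` and the big A-letter `P70_u = (ω',1)@k ⊗ (−iω',2)@sides`. -/
def p46 (k : Fin 4) (a : Fin 4) : Cell := fun f => if f = k then (5, a) else (0, 0)
def p53 (k : Fin 4) (a : Fin 4) : Cell := fun f => if f = k then (4, a) else (0, 0)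
def p70 (k : Fin 4) (a : Fin 4) : Cell := fun f => if f = k then (1, a) else (2, a + 3)
/-- The one-factor position letters of N: `N35 = (ω,1)@k`, `N30 = (ω,2)@k`, `N17 = (ω,3)@k`. -/
def npos (c : ℕ) (k : Fin 4) (a : Fin 4) : Cell := fun f => if f = k then (c, a) else (0, 0)

/-- (N3a) `H²(X, Hom(C, N18_w)) = 0` for all sixteen `w` (in fact `H^j = 0` for `j < 4`). -/
theorem h2_hom_hub_n18 : ∀ k a : Fin 4, hj 2 hub (n18 k a) = 0 ∧ hj 3 hub (n18 k a) = 0 := by decide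

/-- (N3b) `Hom(N18_w, H)` is positive null on every factor: per factor `h² = 0` (so `H²(S_f, ·) = 0`). -/
theorem posNull_hom_n18_hub : ∀ k a f : Fin 4, (hfac (n18 k a f) (hub f)).2.2 = 0 ∧
    0 < (hfac (n18 k a f) (hub f)).1 := by decide

/-- (N3c) `Hom(A, N18) = 0`: no tower and no P70 maps to any N18. -/
theorem h0_hom_A_n18 : ∀ k a k' a' : Fin 4,
    hj 0 (p46 k a) (n18 k' a') = 0 ∧ hj 0 (p53 k a) (n18 k' a') = 0 ∧
    hj 0 (p70 k a) (n18 k' a') = 0 := by decide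

/-- (N1/N2 bookkeeping) the one-factor letters map to the hub through ONE factor only:
`h⁰(Hom(N_c@k, H))` per factor is `c` at `k` and `1` elsewhere (so the column is `s ⊗ v`, memo 2.1). -/
theorem h0_hom_npos_hub : ∀ k a f : Fin 4, ∀ c ∈ [1, 2, 3],
    (hfac (npos c k a f) (hub f)).1 = (if f = k then c else 1) := by decide

/-- The hub square: `h²(End H) = h²(𝒪_X) = 28 = 4 (pure) + 24 (mixed)`; the proof uses the 4 pure ones. -/
theorem h2_end_hub : hj 2 hub hub = 28 ∧ hj 1 hub hub = 8 ∧ hj 0 hub hub = 1 := by decide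

/-! ## §3 The bound and the table -/

/-- `dim ⋂_k ker σ_k ≥ hubTraceLB c s = 4((c − s)² − 1)` (memo THEOREM HUB-TRACE; `s = dim S`). -/
def hubTraceLB (c s : ℕ) : ℕ := 4 * ((c - s) ^ 2 - 1)

/-- D48 = 𝔇₁₆ and T40 = 𝔇₂₄ with `s = 12` of record. -/
theorem row_D48 : hubTraceLB 16 12 = 60 := by decide
theorem row_T40 : hubTraceLB 24 12 = 572 := by decide
/-- H40 (hub ∈ N, `e = 1`): `s + e = 13`, `c = 25`. -/
theorem row_H40 : hubTraceLB 25 13 = 572 := by decide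

/-- The TWIST ray `𝔇_c`, `c = 12 … 28` (memo §5 / `data/hubtrace-ray-table.tsv`). -/
theorem ray_table : (List.range 17).map (fun t => hubTraceLB (12 + t) 12) =
    [0, 0, 12, 32, 60, 96, 140, 192, 252, 320, 396, 480, 572, 672, 780, 896, 1020] := by decide

/-- On the ray the law bites exactly from `c = 14` on (`c − s ≥ 2`). -/
theorem ray_bites_iff : ∀ t < 17, (0 < hubTraceLB (12 + t) 12 ↔ 2 ≤ t) := by decide

/-- With `s ≤ 12` (Theorem S: `S = Σ_w V_w`, `dim V_w ≤ 3`) the bound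
at `s = 12` is the weakest one for `c ≥ 14`: monotone in `s`. -/
theorem lb_mono_in_s : ∀ c < 29, ∀ s ≤ 12, 14 ≤ c → hubTraceLB c 12 ≤ hubTraceLB c s := by decide

/-- σ-target dimensions on the abelian 8-fold `X` (`h^{p,q} = C(8,p) C(8,q)`):
`I = {4}` (form degree 3): 3136; `{k ≤ 3}` (c4-1's window): 5572; all `k ≤ 6`: 8008. -/
theorem sigma_targets : Nat.choose 8 3 * Nat.choose 8 5 = 3136 ∧
    ((List.range 4).map fun k => Nat.choose 8 k * Nat.choose 8 (k + 2)).sum = 5572 ∧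
    ((List.range 7).map fun k => Nat.choose 8 k * Nat.choose 8 (k + 2)).sum = 8008 := by decide

/-- Even the crude comparison is not what decides: the kernel (60, 572) is far below every target,
i.e. the verdict is structural (σ-blind classes), not a pigeonhole. -/
theorem kernel_lt_targets : hubTraceLB 16 12 < 3136 ∧ hubTraceLB 24 12 < 3136 := by decide

/-- TRACE ROW (memo §4(c)): `q_k = r · 14^k` for D48 (`r = 48`) — the numbers of `classq.py`. -/
theorem trace_row_D48 : (List.range 5).map (fun k => 48 * 14 ^ k) = [48, 672, 9408, 131712, 1843968] := by
  decide

/-- χ(L,L) letter checksum (memo §4): `2|μ|² = 2 · 256² = 131072`. -/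
theorem chi_checksum : 2 * 256 ^ 2 = 131072 := by decide

end Summit.Ventures.HSemireg.B3HubTrace
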